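import Summits.AtomisticToContinuum.HydrodynamicLimit.Theses.TwoClocks
import Summits.AtomisticToContinuum.HydrodynamicLimit.Theses.OneFlightGossipEngine
import Summits.AtomisticToContinuum.HydrodynamicLimit.Theorems.OneFlightGossipEngineCollisionActivityTailsActMeasurable
import HarnessLib

/-!
# `CollisionActivityTails` (stmt-AtomisticToContinuum-13734), line `SketchK1`: ONE good window scale per level and
accuracy suffices — for the crux and for every window-convex tail statement

Helper file (`--supports stmt-AtomisticToContinuum-13734`) for the crux
`Summit.AtomisticToContinuum.HydrodynamicLimit.Theses.OneFlightGossipEngine.CollisionActivityTails` (≡ the TwoClocks copy),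
skeleton line `SketchK1`; file 2 of 3, after `…CollisionActivityTailsActMeasurable` (measurability and window additivity of
the activity `a_i = act Φ τ s i`) and before `…CollisionActivityTailsOneWindowTails` (the same reduction for the line's two
tail-shaped open stubs). Registered helper sub-goal: `stub_collisionActivityTailsIffOneWindow`.

* §3 Scalar tail algebra along window averages: `𝟙{V < a} a ≤ 4 (K+1)⁻¹ Σ_k 𝟙{V/4 < a_k} a_k` whenever
  `0 ≤ a ≤ 2 · avg_k a_k`, `a_k ≥ 0`, `V ≥ 0` (`tailFn_le_four_mul_avg`).
* §4 The common frame `TailStatement F` of the crux and of the line's tail-shaped stubs (the standing disprover's frame,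
  `Cruxes/CollisionActivityTails/Disproof.lean` §6b) and its ONE-WINDOW form `OneWindowTailStatement F`
  (`∃ τ₀ ∀ τ ≥ τ₀ ∃ N₀ …` replaced by `∃ τ > 0 ∃ N₀ …`); the EQUIVALENCE `tailStatement_iff_oneWindow` for every WINDOW-CONVEX
  functional (`WindowConvex F`: nonnegative, a.e.-measurable tail sums for `σ` below a threshold, and
  `F(τ) ≤ 2 · (K+1)⁻¹ Σ_{k ≤ K} F(τ₁, start s + k w₁)` on the good set whenever `K τ₁ ≤ τ ≤ (K+1) τ₁`, `K ≥ 1` — window averages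
  and window collision sums are such). Content of the non-trivial direction (`tailStatement_of_oneWindow`): given `t < T` work on
  `t' = (t+T)/2`; for `τ ≥ τ₁` (the good scale for level `V/4`, accuracy `ε/4`) and `K = ⌊τ/τ₁⌋ ≥ 1`, once
  `window ((K+1)τ₁) N ≤ t' − t` every start `s + k w₁ ≤ t'`, the `L¹` tail of `F(τ)` above `V` is at most `4 ×` the average of
  the `K + 1` one-window tails above `V/4` (good set); integrate (the local Gibbs law is carried by the good set), split the finite
  sum and use the one-window bound `K + 1` times.
* §5 The instance `F = act`: the crux (both route decls, definitionally `TailStatement act`) is equivalent to its one-window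
  form `CollisionActivityTailsOneWindow` (`stub_collisionActivityTailsIffOneWindow`; `windowConvex_act` from file 1). Reading: the
  crux is not a statement about a `τ → ∞` LIMIT — for every level and accuracy it asks for ONE mesoscopic window scale at which
  the tagged activity's `L¹` tail is small for all large `N`, uniformly in the start. (The TAIL shape is used: the line's
  FRACTION-shaped statements `…FractionLLN` are not monotone along window averages, `𝟙{V < avg} ≰ avg 𝟙{V < ·}`.)

References: H. Spohn, *Large Scale Dynamics of Interacting Particles* (1991), Part I §2.3 (local Gibbs states);
C. Cercignani, R. Illner, M. Pulvirenti, *The Mathematical Theory of Dilute Gases* (1994), §4.2 (time averages along the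
hard-sphere flow). Elementary; recorded here.

Maintenance (2026-08-17, dependency-drift repair). Route `TwoClocks` rev 10 (2026-08-16T20:17Z) RESTATED its copy of the crux
as `TransferActivityTails` (stmt-16624, a different activity), so the decl `…Theses.TwoClocks.CollisionActivityTails` no longer
exists; the shared item stmt-13734 survives as `…Theses.OneFlightGossipEngine.CollisionActivityTails` (byte-identical body), on
which this file's own `collisionActivityTails_iff_oneWindow` is stated. The registered helper
`stub_collisionActivityTailsIffOneWindow` was stated on the TwoClocks copy and stopped elaborating (full build 2026-08-17);
Theorems files being append-only, it is kept as a DEPRECATED ALIAS of `collisionActivityTails_iff_oneWindow` — the same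
equivalence on the surviving copy of the crux. Nothing else changed.
-/

noncomputable section

open MeasureTheory Set Filter Topology
open scoped ENNReal

namespace Summit.AtomisticToContinuum.HydrodynamicLimit.Theorems.CollisionActivityTailsWindowAlgebra

open Literature.MathematicalPhysics.KineticTheory Literature.Analysis.FluidPDE
open Summit.AtomisticToContinuum.HydrodynamicLimit.Theorems.CollisionActivityTailsActivityDomination
open Summit.AtomisticToContinuum.HydrodynamicLimit.Theorems.CollisionActivityTailsNearFieldKineticTails (tailFn
  tailFn_of_lt tailFn_of_le tailFn_nonneg le_add_tailFn exists_window_le)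

/-! ## §3 Scalar tail algebra along window averages -/

/-- **One-window tail algebra.** If `0 ≤ a ≤ 2 · (K+1)⁻¹ Σ_{k ≤ K} b_k` with `b_k ≥ 0` and `V ≥ 0`, then
`𝟙{V < a} a ≤ 4 · (K+1)⁻¹ Σ_{k ≤ K} 𝟙{V/4 < b_k} b_k`: on `{a > V}` the average exceeds `V/2`, and `b_k ≤ V/4 + 𝟙{V/4 < b_k} b_k`
leaves at least half of the average to the tails. -/
theorem tailFn_le_four_mul_avg {V a : ℝ} (hV : 0 ≤ V) {K : ℕ} {b : ℕ → ℝ} (hb : ∀ k, 0 ≤ b k)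
    (hle : a ≤ 2 * (((K : ℝ) + 1)⁻¹ * ∑ k ∈ Finset.range (K + 1), b k)) :
    tailFn V a ≤ 4 * (((K : ℝ) + 1)⁻¹ * ∑ k ∈ Finset.range (K + 1), tailFn (V / 4) (b k)) := by
  set A : ℝ := ((K : ℝ) + 1)⁻¹ * ∑ k ∈ Finset.range (K + 1), b k with hA
  set B : ℝ := ((K : ℝ) + 1)⁻¹ * ∑ k ∈ Finset.range (K + 1), tailFn (V / 4) (b k) with hB
  have hK : (0 : ℝ) < (K : ℝ) + 1 := by positivity
  have hB0 : 0 ≤ B := mul_nonneg (inv_nonneg.2 hK.le) (Finset.sum_nonneg fun k _ => tailFn_nonneg (hb k))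
  by_cases hVa : V < a
  · rw [tailFn_of_lt hVa]
    have hsum : ∑ k ∈ Finset.range (K + 1), b k ≤
        ∑ k ∈ Finset.range (K + 1), (V / 4 + tailFn (V / 4) (b k)) :=
      Finset.sum_le_sum fun k _ => le_add_tailFn (by positivity)
    rw [Finset.sum_add_distrib, Finset.sum_const, Finset.card_range, nsmul_eq_mul] at hsum
    have hAB : A ≤ V / 4 + B := by
      have h1 : A ≤ ((K : ℝ) + 1)⁻¹ * ((((K + 1 : ℕ) : ℝ)) * (V / 4) + ∑ k ∈ Finset.range (K + 1), tailFn (V / 4) (b k)) :=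
        mul_le_mul_of_nonneg_left hsum (inv_nonneg.2 hK.le)
      have h2 : ((K : ℝ) + 1)⁻¹ * ((((K + 1 : ℕ) : ℝ)) * (V / 4) + ∑ k ∈ Finset.range (K + 1), tailFn (V / 4) (b k)) =
          V / 4 + B := by
        rw [hB]
        push_cast
        field_simp
      linarith
    linarith
  · rw [tailFn_of_le (not_lt.1 hVa)]
    positivity

/-! ## §4 Tail statements, their one-window form, and the reduction for window-convex functionals -/

/-- A per-particle window functional of the line: `F (Φ N) τ s i z` (window length parameter `τ`, start `s`, particle `i`,
initial datum `z`) — `act`, `nearFieldKinetic`, `crowdedActivity` are such. -/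
abbrev WindowFunctional : Type :=
  ∀ {σ : ℝ} {N : ℕ}, Flow σ N → ℝ → ℝ → Fin (N + 1) → Cfg N → ℝ

/-- **Crux-shaped TAIL STATEMENT** for a window functional `F` (the common frame of the crux and of the line's tail-shaped stubs;
verbatim the standing disprover's `TailStatement`): continuous positive profiles, `σ < σ₀`, classical hs-Euler solutions on
`[0,T)`, every flow family, the `t = 0` LLN, every `t < T`, then
`∃ V₀ ∀ V ≥ V₀ ∀ ε ∃ τ₀ ∀ τ ≥ τ₀ ∃ N₀ ∀ N ≥ N₀ ∀ s ∈ [0,t]: E_{λ₀}[(N+1)⁻¹ Σ_i 𝟙{V < F_i} F_i] ≤ ε`. -/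
def TailStatement (F : WindowFunctional) : Prop :=
  ∀ (a₀ θ₀ : T3 → ℝ) (u₀ : T3 → V3), Continuous a₀ → Continuous θ₀ → Continuous u₀ →
    (∀ x, 0 < a₀ x) → (∀ x, 0 < θ₀ x) → ∃ σ₀ : ℝ, 0 < σ₀ ∧ ∀ σ : ℝ, 0 < σ → σ < σ₀ →
    ∀ (T : ℝ) (ρ θ : ℝ → T3 → ℝ) (u : ℝ → T3 → V3), IsHardSphereEulerSolution σ T ρ u θ →
    ∀ Φ : (N : ℕ) → Flow σ N,
    TendstoHydroFieldsAt (fun N => localGibbsLaw σ a₀ u₀ θ₀ N (Φ N)) Φ ρ u θ 0 →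
    ∀ t ∈ Set.Ico 0 T, ∃ V₀ : ℝ, 0 < V₀ ∧ ∀ V : ℝ, V₀ ≤ V → ∀ ε : ℝ, 0 < ε →
    ∃ τ₀ : ℝ, 0 < τ₀ ∧ ∀ τ : ℝ, τ₀ ≤ τ → ∃ N₀ : ℕ, ∀ N : ℕ, N₀ ≤ N → ∀ s ∈ Set.Icc 0 t,
      ∫⁻ z, ENNReal.ofReal (((N : ℝ) + 1)⁻¹ * ∑ i : Fin (N + 1), tailFn V (F (Φ N) τ s i z))
        ∂(localGibbsLaw σ a₀ u₀ θ₀ N (Φ N)) ≤ ENNReal.ofReal ε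

/-- **ONE-WINDOW FORM** of the tail statement for `F`: same frame, but for each level `V ≥ V₀` and accuracy `ε` only ONE window
scale `τ > 0` (with its own `N₀`) is asked for: `∃ τ > 0 ∃ N₀ ∀ N ≥ N₀ ∀ s ∈ [0,t]: E_{λ₀}[(N+1)⁻¹ Σ_i 𝟙{V < F_i} F_i] ≤ ε`. -/
def OneWindowTailStatement (F : WindowFunctional) : Prop :=
  ∀ (a₀ θ₀ : T3 → ℝ) (u₀ : T3 → V3), Continuous a₀ → Continuous θ₀ → Continuous u₀ →
    (∀ x, 0 < a₀ x) → (∀ x, 0 < θ₀ x) → ∃ σ₀ : ℝ, 0 < σ₀ ∧ ∀ σ : ℝ, 0 < σ → σ < σ₀ →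
    ∀ (T : ℝ) (ρ θ : ℝ → T3 → ℝ) (u : ℝ → T3 → V3), IsHardSphereEulerSolution σ T ρ u θ →
    ∀ Φ : (N : ℕ) → Flow σ N,
    TendstoHydroFieldsAt (fun N => localGibbsLaw σ a₀ u₀ θ₀ N (Φ N)) Φ ρ u θ 0 →
    ∀ t ∈ Set.Ico 0 T, ∃ V₀ : ℝ, 0 < V₀ ∧ ∀ V : ℝ, V₀ ≤ V → ∀ ε : ℝ, 0 < ε →
    ∃ τ : ℝ, 0 < τ ∧ ∃ N₀ : ℕ, ∀ N : ℕ, N₀ ≤ N → ∀ s ∈ Set.Icc 0 t,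
      ∫⁻ z, ENNReal.ofReal (((N : ℝ) + 1)⁻¹ * ∑ i : Fin (N + 1), tailFn V (F (Φ N) τ s i z))
        ∂(localGibbsLaw σ a₀ u₀ θ₀ N (Φ N)) ≤ ENNReal.ofReal ε

/-- **WINDOW-CONVEX functionals**: what the one-window reduction consumes. `F` is nonnegative (for `σ, τ > 0`); its tail sums
are a.e.-measurable under the local Gibbs law for `σ` below a threshold `σm`; and on the good set a long window is dominated by
twice the average of the adjacent short windows it contains: `F(τ, s) ≤ 2 (K+1)⁻¹ Σ_{k ≤ K} F(τ₁, s + k w₁)` whenever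
`K τ₁ ≤ τ ≤ (K+1) τ₁`, `K ≥ 1`, `w₁ = window τ₁ N` (window AVERAGES of nonnegative observables and `(σ/τ) ×` window collision
sums are such: additive over adjacent windows and monotone in the window). -/
structure WindowConvex (F : WindowFunctional) : Prop where
  nonneg : ∀ {σ : ℝ} {N : ℕ} (Φ : Flow σ N) {τ : ℝ} (s : ℝ) (i : Fin (N + 1)) (z : Cfg N), 0 < σ → 0 < τ →
    0 ≤ F Φ τ s i z
  le_two_mul_avg : ∀ {σ : ℝ} {N : ℕ} (Φ : Flow σ N) {z : Cfg N}, 0 < σ → z ∈ Φ.good → ∀ {τ₁ τ : ℝ}, 0 < τ₁ →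
    ∀ {K : ℕ}, 1 ≤ K → (K : ℝ) * τ₁ ≤ τ → τ ≤ ((K : ℝ) + 1) * τ₁ → ∀ (s : ℝ) (i : Fin (N + 1)),
      F Φ τ s i z ≤ 2 * (((K : ℝ) + 1)⁻¹ * ∑ k ∈ Finset.range (K + 1), F Φ τ₁ (s + k * window τ₁ N) i z)
  aemeasurable : ∃ σm : ℝ, 0 < σm ∧ ∀ {σ : ℝ}, 0 < σ → σ < σm → ∀ (a₀ θ₀ : T3 → ℝ) (u₀ : T3 → V3) (N : ℕ)
    (Φ : Flow σ N) {τ : ℝ}, 0 < τ → ∀ (s V : ℝ),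
      AEMeasurable (fun z => ∑ i : Fin (N + 1), tailFn V (F Φ τ s i z)) (localGibbsLaw σ a₀ u₀ θ₀ N Φ)

/-- A tail statement implies its one-window form (take `τ = τ₀`). -/
theorem oneWindow_of_tailStatement {F : WindowFunctional} (h : TailStatement F) : OneWindowTailStatement F := by
  intro a₀ θ₀ u₀ ha hθ hu ha0 hθ0
  obtain ⟨σ₀, hσ₀, h⟩ := h a₀ θ₀ u₀ ha hθ hu ha0 hθ0
  refine ⟨σ₀, hσ₀, fun σ hσ hσlt T ρ θ u hsol Φ hLLN t ht => ?_⟩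
  obtain ⟨V₀, hV₀, h⟩ := h σ hσ hσlt T ρ θ u hsol Φ hLLN t ht
  refine ⟨V₀, hV₀, fun V hV ε hε => ?_⟩
  obtain ⟨τ₀, hτ₀, h⟩ := h V hV ε hε
  obtain ⟨N₀, h⟩ := h τ₀ le_rfl
  exact ⟨τ₀, hτ₀, N₀, fun N hN s hs => h N hN s hs⟩

/-- **ONE GOOD WINDOW SUFFICES** for every window-convex functional: the one-window form implies the tail statement.
Given `t < T` work on the extended horizon `t' = (t+T)/2`; take `σ₀ = min σ₀' σm`, `V₀ = 4 V₀'`; for `V ≥ V₀` and `ε` let `τ₁`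
be the good window for level `V/4` and accuracy `ε/4`, and `τ₀ = τ₁`. For `τ ≥ τ₁` write `K = ⌊τ/τ₁⌋ ≥ 1`; once `N` is so large
that `window ((K+1)τ₁) N ≤ t' − t`, on the good set `F(τ, s) ≤ 2 (K+1)⁻¹ Σ_{k ≤ K} F(τ₁, s + k w₁)` with all starts
`s + k w₁ ≤ t'`, so `𝟙{V < F} F ≤ 4 (K+1)⁻¹ Σ_k 𝟙{V/4 < F(τ₁, s + k w₁)} F(τ₁, s + k w₁)` (`tailFn_le_four_mul_avg`); integrate
(the law is carried by the good set), split the finite sum (a.e.-measurability) and use the one-window bound `K + 1` times. -/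
theorem tailStatement_of_oneWindow {F : WindowFunctional} (hF : WindowConvex F) (h : OneWindowTailStatement F) :
    TailStatement F := by
  obtain ⟨σm, hσm, hmeas⟩ := hF.aemeasurable
  intro a₀ θ₀ u₀ ha hθ hu ha0 hθ0
  obtain ⟨σ₀, hσ₀, h⟩ := h a₀ θ₀ u₀ ha hθ hu ha0 hθ0
  refine ⟨min σ₀ σm, lt_min hσ₀ hσm, fun σ hσ hσlt T ρ θ u hsol Φ hLLN t ht => ?_⟩
  have hσ₀' : σ < σ₀ := hσlt.trans_le (min_le_left _ _)
  have hσ2 : σ < σm := hσlt.trans_le (min_le_right _ _)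
  -- extended horizon
  obtain ⟨ht0, htT⟩ := ht
  set t' : ℝ := (t + T) / 2 with ht'
  have htt' : t < t' := by rw [ht']; linarith
  have ht'T : t' ∈ Set.Ico 0 T := ⟨by rw [ht']; linarith, by rw [ht']; linarith⟩
  obtain ⟨V₁, hV₁, h⟩ := h σ hσ hσ₀' T ρ θ u hsol Φ hLLN t' ht'T
  refine ⟨4 * V₁, by positivity, fun V hV e he => ?_⟩
  have hV4 : V₁ ≤ V / 4 := by linarith
  have hV0 : 0 ≤ V := by linarith
  obtain ⟨τ₁, hτ₁, N₁, h⟩ := h (V / 4) hV4 (e / 4) (by positivity)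
  refine ⟨τ₁, hτ₁, fun τ hτ => ?_⟩
  have hτ0 : 0 < τ := hτ₁.trans_le hτ
  -- the number `K ≥ 1` of whole windows of length `τ₁` in `τ`
  have hK1 : 1 ≤ ⌊τ / τ₁⌋₊ := (Nat.one_le_floor_iff _).2 ((one_le_div hτ₁).2 hτ)
  have hKτ : (⌊τ / τ₁⌋₊ : ℝ) * τ₁ ≤ τ := (le_div_iff₀ hτ₁).1 (Nat.floor_le (div_nonneg hτ0.le hτ₁.le))
  have hτK : τ ≤ ((⌊τ / τ₁⌋₊ : ℝ) + 1) * τ₁ := ((div_lt_iff₀ hτ₁).1 (Nat.lt_floor_add_one (τ / τ₁))).le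
  generalize ⌊τ / τ₁⌋₊ = K at hK1 hKτ hτK
  -- `N` so large that the long window fits below `t' - t`
  obtain ⟨N₂, hN₂⟩ := exists_window_le (τ := ((K : ℝ) + 1) * τ₁) (c := t' - t) (by positivity) (by linarith)
  refine ⟨max N₁ N₂, fun N hN s hs => ?_⟩
  have hN₁ : N₁ ≤ N := (le_max_left _ _).trans hN
  have hwin : window (((K : ℝ) + 1) * τ₁) N ≤ t' - t := hN₂ N ((le_max_right _ _).trans hN)
  set P := localGibbsLaw σ a₀ u₀ θ₀ N (Φ N) with hP
  -- the starts of the `K + 1` short windows stay below `t'`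
  have hstart : ∀ k ∈ Finset.range (K + 1), s + k * window τ₁ N ∈ Set.Icc 0 t' := by
    intro k hk
    have hk : (k : ℝ) ≤ K := by exact_mod_cast Nat.lt_succ_iff.1 (Finset.mem_range.1 hk)
    have hw0 : 0 ≤ window τ₁ N := (window_pos hτ₁ N).le
    refine ⟨by nlinarith [hs.1], ?_⟩
    have h1 : (k : ℝ) * window τ₁ N ≤ window (((K : ℝ) + 1) * τ₁) N := by
      rw [window_mul]
      nlinarith
    linarith [hs.2]
  have hone : ∀ k ∈ Finset.range (K + 1),
      ∫⁻ z, ENNReal.ofReal (((N : ℝ) + 1)⁻¹ *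
          ∑ i : Fin (N + 1), tailFn (V / 4) (F (Φ N) τ₁ (s + k * window τ₁ N) i z)) ∂P ≤
        ENNReal.ofReal (e / 4) := fun k hk => h N hN₁ _ (hstart k hk)
  -- the one-window averaged tails at the starts `s + k w₁`
  set g : ℕ → Cfg N → ℝ := fun k z =>
    ((N : ℝ) + 1)⁻¹ * ∑ i : Fin (N + 1), tailFn (V / 4) (F (Φ N) τ₁ (s + k * window τ₁ N) i z) with hg
  have hg0 : ∀ k z, 0 ≤ g k z := fun k z =>
    mul_nonneg (by positivity) (Finset.sum_nonneg fun i _ => tailFn_nonneg (hF.nonneg _ _ i z hσ hτ₁))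
  -- pointwise bound on the good set
  have hpt : ∀ z ∈ (Φ N).good,
      ((N : ℝ) + 1)⁻¹ * ∑ i : Fin (N + 1), tailFn V (F (Φ N) τ s i z) ≤
        4 * (((K : ℝ) + 1)⁻¹ * ∑ k ∈ Finset.range (K + 1), g k z) := by
    intro z hz
    have hi : ∀ i : Fin (N + 1), tailFn V (F (Φ N) τ s i z) ≤ 4 * (((K : ℝ) + 1)⁻¹ *
        ∑ k ∈ Finset.range (K + 1), tailFn (V / 4) (F (Φ N) τ₁ (s + k * window τ₁ N) i z)) := fun i =>
      tailFn_le_four_mul_avg hV0 (fun k => hF.nonneg _ _ i z hσ hτ₁)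
        (hF.le_two_mul_avg (Φ N) hσ hz hτ₁ hK1 hKτ hτK s i)
    calc ((N : ℝ) + 1)⁻¹ * ∑ i : Fin (N + 1), tailFn V (F (Φ N) τ s i z)
        ≤ ((N : ℝ) + 1)⁻¹ * ∑ i : Fin (N + 1), (4 * (((K : ℝ) + 1)⁻¹ *
            ∑ k ∈ Finset.range (K + 1), tailFn (V / 4) (F (Φ N) τ₁ (s + k * window τ₁ N) i z))) :=
          mul_le_mul_of_nonneg_left (Finset.sum_le_sum fun i _ => hi i) (by positivity)
      _ = 4 * (((K : ℝ) + 1)⁻¹ * (((N : ℝ) + 1)⁻¹ * ∑ i : Fin (N + 1),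
            ∑ k ∈ Finset.range (K + 1), tailFn (V / 4) (F (Φ N) τ₁ (s + k * window τ₁ N) i z))) := by
          rw [← Finset.mul_sum, ← Finset.mul_sum]
          ring
      _ = 4 * (((K : ℝ) + 1)⁻¹ * (((N : ℝ) + 1)⁻¹ * ∑ k ∈ Finset.range (K + 1),
            ∑ i : Fin (N + 1), tailFn (V / 4) (F (Φ N) τ₁ (s + k * window τ₁ N) i z))) := by
          rw [Finset.sum_comm]
      _ = 4 * (((K : ℝ) + 1)⁻¹ * ∑ k ∈ Finset.range (K + 1), g k z) := by
          rw [Finset.mul_sum]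
  have hae : ∀ᵐ z ∂P, ((N : ℝ) + 1)⁻¹ * ∑ i : Fin (N + 1), tailFn V (F (Φ N) τ s i z) ≤
      4 * (((K : ℝ) + 1)⁻¹ * ∑ k ∈ Finset.range (K + 1), g k z) := by
    filter_upwards [CollisionActivityTailsEndpointTails.ae_mem_good_localGibbsLaw σ a₀ θ₀ u₀ N (Φ N)] with z hz
      using hpt z hz
  have hmg : ∀ k, AEMeasurable (fun z => ENNReal.ofReal (g k z)) P := fun k =>
    ((hmeas hσ hσ2 a₀ θ₀ u₀ N (Φ N) hτ₁ _ (V / 4)).const_mul _).ennreal_ofReal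
  have hbound : ∫⁻ z, ENNReal.ofReal (((N : ℝ) + 1)⁻¹ * ∑ i : Fin (N + 1), tailFn V (F (Φ N) τ s i z)) ∂P ≤
      ENNReal.ofReal e :=
    calc ∫⁻ z, ENNReal.ofReal (((N : ℝ) + 1)⁻¹ * ∑ i : Fin (N + 1), tailFn V (F (Φ N) τ s i z)) ∂P
        ≤ ∫⁻ z, ENNReal.ofReal (4 * (((K : ℝ) + 1)⁻¹ * ∑ k ∈ Finset.range (K + 1), g k z)) ∂P :=
          lintegral_mono_ae (hae.mono fun z hz => ENNReal.ofReal_le_ofReal hz)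
      _ = ENNReal.ofReal (4 * ((K : ℝ) + 1)⁻¹) * ∑ k ∈ Finset.range (K + 1), ∫⁻ z, ENNReal.ofReal (g k z) ∂P := by
          have hz : ∀ z, ENNReal.ofReal (4 * (((K : ℝ) + 1)⁻¹ * ∑ k ∈ Finset.range (K + 1), g k z)) =
              ENNReal.ofReal (4 * ((K : ℝ) + 1)⁻¹) * ∑ k ∈ Finset.range (K + 1), ENNReal.ofReal (g k z) := by
            intro z
            rw [← mul_assoc, ENNReal.ofReal_mul (by positivity), ENNReal.ofReal_sum_of_nonneg fun k _ => hg0 k z]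
          simp_rw [hz]
          rw [lintegral_const_mul' _ _ ENNReal.ofReal_ne_top, lintegral_finsetSum' _ fun k _ => hmg k]
      _ ≤ ENNReal.ofReal (4 * ((K : ℝ) + 1)⁻¹) * ∑ k ∈ Finset.range (K + 1), ENNReal.ofReal (e / 4) :=
          mul_le_mul' le_rfl (Finset.sum_le_sum fun k hk => hone k hk)
      _ = ENNReal.ofReal e := by
          rw [Finset.sum_const, Finset.card_range, nsmul_eq_mul, ← ENNReal.ofReal_natCast,
            ← ENNReal.ofReal_mul (by positivity), ← ENNReal.ofReal_mul (by positivity)]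
          congr 1
          push_cast
          field_simp
  exact hbound

/-- **A window-convex functional's tail statement is equivalent to its one-window form.** -/
theorem tailStatement_iff_oneWindow {F : WindowFunctional} (hF : WindowConvex F) :
    TailStatement F ↔ OneWindowTailStatement F :=
  ⟨oneWindow_of_tailStatement, tailStatement_of_oneWindow hF⟩

/-! ## §5 The instance `F = act`: the crux and its one-window form -/

/-- The window activity is window-convex (file 1: `act_nonneg`, `act_le_two_mul` with `act_succ_mul_eq_avg`,
`aemeasurable_sum_tailFn_act` for `σ < 1/2`). -/
theorem windowConvex_act : WindowConvex (fun Φ τ s i z => act Φ τ s i z) where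
  nonneg Φ τ s i z hσ hτ := act_nonneg hσ.le Φ hτ.le s i z
  le_two_mul_avg Φ z hσ hz τ₁ τ hτ₁ K hK hKτ hτK s i := by
    rw [← act_succ_mul_eq_avg Φ hz hτ₁ s i K]
    exact act_le_two_mul hσ.le Φ hz hτ₁ hK hKτ hτK s i
  aemeasurable := ⟨2⁻¹, by norm_num, fun hσ hσ2 a₀ θ₀ u₀ N Φ _τ _ s V =>
    aemeasurable_sum_tailFn_act hσ hσ2 a₀ θ₀ u₀ N Φ _ s V⟩

/-- **ONE-WINDOW FORM of the crux `CollisionActivityTails`** (explicitly): same frame as the crux, but for each level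
`V ≥ V₀` and accuracy `ε` only ONE window scale `τ > 0` is asked for (with its own `N₀`):
`∃ τ > 0 ∃ N₀ ∀ N ≥ N₀ ∀ s ∈ [0,t]: E_{λ₀}[(N+1)⁻¹ Σ_i 𝟙{V < a_i} a_i] ≤ ε`, `a_i = act (Φ N) τ s i`. Definitionally
`OneWindowTailStatement act`; equivalent to the crux (`stub_collisionActivityTailsIffOneWindow`). -/
def CollisionActivityTailsOneWindow : Prop :=
  ∀ (a₀ θ₀ : T3 → ℝ) (u₀ : T3 → V3), Continuous a₀ → Continuous θ₀ → Continuous u₀ →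
    (∀ x, 0 < a₀ x) → (∀ x, 0 < θ₀ x) → ∃ σ₀ : ℝ, 0 < σ₀ ∧ ∀ σ : ℝ, 0 < σ → σ < σ₀ →
    ∀ (T : ℝ) (ρ θ : ℝ → T3 → ℝ) (u : ℝ → T3 → V3), IsHardSphereEulerSolution σ T ρ u θ →
    ∀ Φ : (N : ℕ) → Flow σ N,
    TendstoHydroFieldsAt (fun N => localGibbsLaw σ a₀ u₀ θ₀ N (Φ N)) Φ ρ u θ 0 →
    ∀ t ∈ Set.Ico 0 T, ∃ V₀ : ℝ, 0 < V₀ ∧ ∀ V : ℝ, V₀ ≤ V → ∀ ε : ℝ, 0 < ε →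
    ∃ τ : ℝ, 0 < τ ∧ ∃ N₀ : ℕ, ∀ N : ℕ, N₀ ≤ N → ∀ s ∈ Set.Icc 0 t,
      ∫⁻ z, ENNReal.ofReal (((N : ℝ) + 1)⁻¹ * ∑ i : Fin (N + 1), tailFn V (act (Φ N) τ s i z))
        ∂(localGibbsLaw σ a₀ u₀ θ₀ N (Φ N)) ≤ ENNReal.ofReal ε

/-- The crux (OneFlightGossipEngine copy) is, definitionally, the tail statement of the activity. -/
theorem collisionActivityTails_iff_tailStatement_act :
    Summit.AtomisticToContinuum.HydrodynamicLimit.Theses.OneFlightGossipEngine.CollisionActivityTails ↔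
      TailStatement (fun Φ τ s i z => act Φ τ s i z) :=
  Iff.rfl

/-- The one-window form of the crux is, definitionally, the one-window tail statement of the activity. -/
theorem collisionActivityTailsOneWindow_iff :
    CollisionActivityTailsOneWindow ↔ OneWindowTailStatement (fun Φ τ s i z => act Φ τ s i z) :=
  Iff.rfl

/-- **The crux is equivalent to its one-window form** (OneFlightGossipEngine copy of the decl). -/
theorem collisionActivityTails_iff_oneWindow :
    Summit.AtomisticToContinuum.HydrodynamicLimit.Theses.OneFlightGossipEngine.CollisionActivityTails ↔
      CollisionActivityTailsOneWindow :=
  tailStatement_iff_oneWindow windowConvex_act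

/-- **STUB `stub_collisionActivityTailsIffOneWindow` (line `SketchK1`, registered helper sub-goal)** — deprecated
spelling: it stated the equivalence of the crux with its one-window form on the TwoClocks copy of the decl
(`…Theses.TwoClocks.CollisionActivityTails`), which route `TwoClocks` rev 10 (2026-08-16) restated as the different
`TransferActivityTails`; the equivalence on the surviving, byte-identical OneFlightGossipEngine copy (the shared item
stmt-AtomisticToContinuum-13734) is `collisionActivityTails_iff_oneWindow`, of which the registered name is kept as a
deprecated alias (Theorems files are append-only; dependency-drift repair 2026-08-17). -/
@[deprecated collisionActivityTails_iff_oneWindow (since := "2026-08-17")]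
alias stub_collisionActivityTailsIffOneWindow := collisionActivityTails_iff_oneWindow

end Summit.AtomisticToContinuum.HydrodynamicLimit.Theorems.CollisionActivityTailsWindowAlgebra

end
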